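import Literature.MathematicalPhysics.QuantumLattice.HubbardTPPClusterFloorInfVol
import Literature.MathematicalPhysics.QuantumLattice.HubbardNNNHoppingClusterLowerBound2x3
import HarnessLib

/-!
# The infinite-volume cluster floor for object M from ONE table: transposition symmetry of the open `t–t'–t''`
# cluster, the single-table law `2m − 12μρ ≤ e^M`, and the `t'' = 0` bridge to the landed `2 × 3` tables

Topic `MathematicalPhysics/QuantumLattice`, family `hubbard`. Companion of `HubbardTPPClusterFloorInfVol`
(`tiGroundEnergyDensityAt_tpp_ge_of_boxFloors_2x3`, two tables for the open `3 × 2` and `2 × 3` clusters).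
The coordinate swap carries the open `c × r` `t–t'–t''` cluster onto the `r × c` one — nearest-neighbour,
diagonal AND third-neighbour (axial range-2) bonds alike — so the sector ground energies agree
(`groundEnergy_hubbardOpenBoxTT'T''_swap`, the `t''` twin of `groundEnergy_hubbardOpenBoxTT'_swap`); hence ONE
kernel table `σ_k ≤ E₀(hubbardOpenBoxTT'T'' 2 3 (t/7) (t'/4) (t''/2) (U/12), k)` with one supporting line gives
`2m − 12μρ ≤ e^M(t,t',t'',U; ρ)` (`tiGroundEnergyDensityAt_tpp_ge_of_boxFloors_2x3_oneTable`) — the exact shape the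
KLDL certificate files deliver (`kacf2x3_<tag>_table`) once they carry the axial term; and at `t'' = 0` the landed
`t–t'` tables feed it as they are (`…_of_ttPrimeTable`). Everything is proved; no definition.

## References

* P. W. Anderson, Phys. Rev. 83 (1951) 1260, eq. (2). [cite: Anderson1951, eq. (2)]
* O. Bratteli, D. W. Robinson, *OAQSM 2* (1997), §5.2.2 (covariance of second quantisation). [cite: BratteliRobinsonII1997, §5.2.2]
* E. Pavarini et al., Phys. Rev. Lett. 87 (2001) 047003, eq. (1). [cite: PavariniEtAl2001, eq. (1)]
-/

noncomputable section

namespace Literature.MathematicalPhysics.QuantumLattice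

open Matrix Finset
open scoped ComplexOrder

/-- **Transposition symmetry of the open `t–t'–t''` cluster**: the sector ground energies of the open `c × r` and
`r × c` clusters agree (the coordinate swap preserves nearest-neighbour, diagonal and axial range-2 adjacency).
[cite: BratteliRobinsonII1997, §5.2.2] -/
theorem groundEnergy_hubbardOpenBoxTT'T''_swap (r c : ℕ) (t t' t'' U : ℝ) (N : ℕ) :
    groundEnergy (hubbardOpenBoxTT'T'' c r t t' t'' U) N = groundEnergy (hubbardOpenBoxTT'T'' r c t t' t'' U) N := by
  have hH : ∀ x y, (rectBoxGraph c r).Adj (rectSwap r c x) (rectSwap r c y) ↔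
      (rectBoxGraph r c).Adj x y := by
    intro x y
    show ((ofLex x).1 = (ofLex y).1 ∧ lineAdj (ofLex x).2 (ofLex y).2) ∨
        ((ofLex x).2 = (ofLex y).2 ∧ lineAdj (ofLex x).1 (ofLex y).1) ↔
      ((ofLex x).2 = (ofLex y).2 ∧ lineAdj (ofLex x).1 (ofLex y).1) ∨
        ((ofLex x).1 = (ofLex y).1 ∧ lineAdj (ofLex x).2 (ofLex y).2)
    exact Or.comm
  have hH' : ∀ x y, (rectBoxDiagGraph c r).Adj (rectSwap r c x) (rectSwap r c y) ↔
      (rectBoxDiagGraph r c).Adj x y := by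
    intro x y
    show lineAdj (ofLex x).2 (ofLex y).2 ∧ lineAdj (ofLex x).1 (ofLex y).1 ↔
      lineAdj (ofLex x).1 (ofLex y).1 ∧ lineAdj (ofLex x).2 (ofLex y).2
    exact And.comm
  have hH'' : ∀ x y, (rectBoxAxial2Graph c r).Adj (rectSwap r c x) (rectSwap r c y) ↔
      (rectBoxAxial2Graph r c).Adj x y := by
    intro x y
    show ((ofLex x).1 = (ofLex y).1 ∧ line2Adj (ofLex x).2 (ofLex y).2) ∨
        ((ofLex x).2 = (ofLex y).2 ∧ line2Adj (ofLex x).1 (ofLex y).1) ↔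
      ((ofLex x).2 = (ofLex y).2 ∧ line2Adj (ofLex x).1 (ofLex y).1) ∨
        ((ofLex x).1 = (ofLex y).1 ∧ line2Adj (ofLex x).2 (ofLex y).2)
    exact Or.comm
  rw [hubbardOpenBoxTT'T''_def, hubbardOpenBoxTT'T''_def, hubbardOpenBoxTT', hubbardOpenBoxTT',
    ← groundEnergy_relabel (Orb.mapEquiv (rectSwap r c))
      (hamiltonian (rectBoxGraph r c) t U + hamiltonian (rectBoxDiagGraph r c) t' 0 +
        hamiltonian (rectBoxAxial2Graph r c) t'' 0) N,
    map_add, map_add, relabel_hamiltonian (rectBoxGraph r c) (rectBoxGraph c r) (rectSwap r c) hH t U,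
    relabel_hamiltonian (rectBoxDiagGraph r c) (rectBoxDiagGraph c r) (rectSwap r c) hH' t' 0,
    relabel_hamiltonian (rectBoxAxial2Graph r c) (rectBoxAxial2Graph c r) (rectSwap r c) hH'' t'' 0]

namespace InfVolFermionState

/-- **THE SINGLE-TABLE LAW.** One kernel table of sector floors of the open `2 × 3` `t–t'–t''` cluster at the
Anderson weights, `σ_k ≤ E₀(hubbardOpenBoxTT'T'' 2 3 (t/7) (t'/4) (t''/2) (U/12), k)` (`k ≤ 12`), and one supporting
line `m ≤ σ_k + μk` give `2m − 12μρ ≤ e^M(t,t',t'',U; ρ)` at every `0 < ρ < 2` — EXACT in `t''`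
(the `3 × 2` table is the same by `groundEnergy_hubbardOpenBoxTT'T''_swap`). [cite: Anderson1951, eq. (2)] -/
theorem tiGroundEnergyDensityAt_tpp_ge_of_boxFloors_2x3_oneTable {σ : ℕ → ℝ} {t t' t'' U : ℝ}
    (hF : ∀ k ≤ 12, σ k ≤ groundEnergy (hubbardOpenBoxTT'T'' 2 3 (t / 7) (t' / 4) (t'' / 2) (U / 12)) k)
    (μ m : ℝ) (hm : ∀ k ≤ 12, m ≤ σ k + μ * k) {ρ : ℝ} (hρ0 : 0 < ρ) (hρ2 : ρ < 2) :
    2 * m - 12 * μ * ρ ≤ (hubbardTT'T''FermionInteraction t t' t'' U).tiGroundEnergyDensityAt 2 ρ := by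
  have hF' : ∀ k ≤ 12, σ k ≤ groundEnergy (hubbardOpenBoxTT'T'' 3 2 (t / 7) (t' / 4) (t'' / 2) (U / 12)) k :=
    fun k hk => by rw [groundEnergy_hubbardOpenBoxTT'T''_swap]; exact hF k hk
  have h := tiGroundEnergyDensityAt_tpp_ge_of_boxFloors_2x3 hF' hF μ m μ m hm hm hρ0 hρ2
  linarith

/-- **`t'' = 0` bridge**: a landed table for the open `2 × 3` `t–t'` cluster `hubbardOpenBoxTT' 2 3 (t/7) (t'/4) (U/12)`
(the KLDL `kacf2x3_<tag>_table` shape) bounds object M at `t'' = 0`: `2m − 12μρ ≤ e^M(t,t',0,U; ρ)` — the same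
number as the torus law gives for the `t–t'` energy density, now for the fixed-filling variational object directly.
[cite: Anderson1951, eq. (2)] -/
theorem tiGroundEnergyDensityAt_tpp_zero_ge_of_ttPrimeTable {σ : ℕ → ℝ} {t t' U : ℝ}
    (hF : ∀ k ≤ 12, σ k ≤ groundEnergy (hubbardOpenBoxTT' 2 3 (t / 7) (t' / 4) (U / 12)) k)
    (μ m : ℝ) (hm : ∀ k ≤ 12, m ≤ σ k + μ * k) {ρ : ℝ} (hρ0 : 0 < ρ) (hρ2 : ρ < 2) :
    2 * m - 12 * μ * ρ ≤ (hubbardTT'T''FermionInteraction t t' 0 U).tiGroundEnergyDensityAt 2 ρ := by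
  refine tiGroundEnergyDensityAt_tpp_ge_of_boxFloors_2x3_oneTable (fun k hk => ?_) μ m hm hρ0 hρ2
  rw [zero_div, hubbardOpenBoxTT'T''_zero]
  exact hF k hk

end InfVolFermionState

end Literature.MathematicalPhysics.QuantumLattice

end
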